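import Literature.MathematicalPhysics.QuantumFieldTheory.VillainEnsembleProjection
import HarnessLib

/-!
# The monopole gas of the Villain model on a cube as a convex combination of Gaussian averages of
# 1-ensembles of CLOSED current densities (FS82 Lemma 2 + (2.43)–(2.44), regulator-free)

Support file for the Coulomb-gas (monopole) representation of four-dimensional `U(1)` lattice gauge
theory with the Villain action (proof programme of the named fact
`Literature.MathematicalPhysics.QuantumFieldTheory.FrohlichSpencerU1PerimeterLawD4` and of its
corollary `Literature.Barriers.QuantumFields.AbelianDeconfinementD4`). For one multiplicity pattern
`κ ∈ ℕ_{≥1}^{cubes}` of the resummed gas (`VillainKacSiegertTorus.gasNum_eq_tsum_kappa`) the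
product over cubes `∏_c (1 + z_{κ_c} cos(κ_c α_c))` is expanded into 1-ensembles by
`FrohlichSpencerEnsembleExpansion.exists_oneEnsemble_expansion` (coarse adjacency `adjC`), the order
of the torus and Gaussian integrations is exchanged (Fubini), and the torus average projects every
term onto its closed densities (`VillainEnsembleProjection.integral_torus_ensembleProd`):

* `closeT` (kill the activities of non-closed densities), `continuous_eval`/`continuous_evalSum`,
  `integral_torus_eval`, `integral_torus_evalSum`;
* **`exists_closed_ensemble_expansion`**: for `β > 0`, `z > 0` and `κ ≥ 1` there is a list of terms
  `(c_γ > 0, ∑ c_γ = 1, 𝒩_γ` a 1-ensemble of non-zero densities with `|ρ_b| = κ_b` on their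
  (adjC-connected) supports, activities `0 ≤ K_γ(ρ) ≤ 3^{N₁(supp ρ)} ∏_{b ∈ supp ρ} z_{κ_b}`,
  and `K_γ(ρ) = 0` unless `dρ = 0`) with
  `∫_{[0,1)^Q}∫ e^{-½aᵀPa} ∏_c (1 + z_{κ_c} cos(κ_c(a_c + ψ_c + 2π(Eᵀb)_c))) da db = ∫ e^{-½aᵀPa} (∑_γ c_γ ∏_{ρ∈𝒩_γ}(1 + K_γ(ρ) cos ρ(a + ψ))) da`
  for both `ψ = 2πB'⁻¹DS` and `ψ = 0`.

Everything is proved; no named fact is introduced.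

## References

* J. Fröhlich, T. Spencer, Comm. Math. Phys. 83 (1982) 411–454, §2.6 Lemma 2, (2.41)–(2.44).
  [FrohlichSpencerCMP1982]
-/

noncomputable section

open Finset Function Matrix Filter Topology MeasureTheory Set
open scoped Real
open Literature.Probability.LatticeModels
open Literature.Probability.LatticeModels.EnsembleExpansion (phase ensembleProd Term evalSum weightSum IsOneEnsemble nbhd
  IsAdjConnected exists_oneEnsemble_expansion evalSum_cons evalSum_nil)

namespace Literature.MathematicalPhysics.QuantumFieldTheory

namespace VillainAngle

open AxialGauge LatticeForm LatticeChain VillainFibre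

variable {d n : ℕ}

/-! ### Killing the non-closed densities -/

open Classical in
/-- Replace the activity of every non-closed density by zero. [cite: FrohlichSpencerCMP1982, §2.6 (2.43)–(2.44)] -/
def closeT (t : Term (CIdx d n)) : Term (CIdx d n) :=
  ⟨t.weight, t.family, fun ρ => if EInt ρ = 0 then t.activity ρ else 0⟩

/-- `closeT` keeps the weight. [folklore] -/
@[simp] theorem closeT_weight (t : Term (CIdx d n)) : (closeT t).weight = t.weight := rfl
/-- `closeT` keeps the family. [folklore] -/
@[simp] theorem closeT_family (t : Term (CIdx d n)) : (closeT t).family = t.family := rfl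
open Classical in
/-- The activities of `closeT`. [folklore] -/
theorem closeT_activity (t : Term (CIdx d n)) (ρ : CIdx d n →₀ ℤ) :
    (closeT t).activity ρ = if EInt ρ = 0 then t.activity ρ else 0 := rfl

/-- `closeT` keeps the total weight. [folklore] -/
theorem weightSum_map_closeT (L : List (Term (CIdx d n))) : weightSum (L.map closeT) = weightSum L := by
  unfold weightSum
  rw [List.map_map]
  rfl

/-! ### Continuity -/

/-- The phase is continuous in the field. [folklore] -/
theorem continuous_phase (ρ : CIdx d n →₀ ℤ) : Continuous fun α : CIdx d n → ℝ => phase ρ α := by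
  have : (fun α : CIdx d n → ℝ => phase ρ α) = fun α => (fun b => (ρ b : ℝ)) ⬝ᵥ α :=
    funext fun α => phase_eq_dotProduct ρ α
  rw [this]
  exact continuous_const.dotProduct continuous_id

/-- A term is a continuous function of the field. [folklore] -/
theorem continuous_eval (t : Term (CIdx d n)) : Continuous fun α : CIdx d n → ℝ => t.eval α := by
  unfold Term.eval ensembleProd
  exact continuous_const.mul (continuous_finsetProd _ fun ρ _ =>
    continuous_const.add (continuous_const.mul (Real.continuous_cos.comp (continuous_phase ρ))))

/-- The value of a list of terms is a continuous function of the field. [folklore] -/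
theorem continuous_evalSum (L : List (Term (CIdx d n))) : Continuous fun α : CIdx d n → ℝ => evalSum L α := by
  induction L with
  | nil => simp only [evalSum_nil]; exact continuous_const
  | cons t L ih => simp only [evalSum_cons]; exact (continuous_eval t).add ih

/-! ### Torus averages of terms -/

/-- **Torus average of one term**: `∫_{[0,1)^Q} c ∏_ρ (1 + K cos ρ(α + 2πEᵀb)) db = (closeT t)(α)` for a
1-ensemble. [cite: FrohlichSpencerCMP1982, §2.6 (2.43)–(2.44)] -/
theorem integral_torus_eval (t : Term (CIdx d n)) (ht : IsOneEnsemble adjC t.family) (α : CIdx d n → ℝ) :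
    ∫ b in Set.pi univ (fun _ : QIdx d n => Ico (0 : ℝ) 1), t.eval (α + torusShift b) = (closeT t).eval α := by
  unfold Term.eval
  rw [integral_const_mul, integral_torus_ensembleProd _ (eDisjoint_of_isOneEnsemble ht)]
  rfl

/-- **Torus average of a list of terms.** [cite: FrohlichSpencerCMP1982, §2.6 (2.43)–(2.44)] -/
theorem integral_torus_evalSum (L : List (Term (CIdx d n))) (hL : ∀ t ∈ L, IsOneEnsemble adjC t.family)
    (α : CIdx d n → ℝ) :
    ∫ b in Set.pi univ (fun _ : QIdx d n => Ico (0 : ℝ) 1), evalSum L (α + torusShift b) = evalSum (L.map closeT) α := by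
  induction L with
  | nil => simp
  | cons t L ih =>
    simp only [List.map_cons, evalSum_cons]
    rw [integral_add, integral_torus_eval t (hL t (by simp)), ih (fun t' ht' => hL t' (by simp [ht']))]
    · exact integrableOn_box_of_continuous ((continuous_eval t).comp (continuous_const.add continuous_torusShift))
    · exact integrableOn_box_of_continuous ((continuous_evalSum L).comp (continuous_const.add continuous_torusShift))

/-! ### Fubini for the product form -/

/-- The product integrand `(b, a) ↦ e^{-½aᵀPa} ∏_c (1 + z_{κ_c} cos(κ_c(a_c + ψ_c + 2π(Eᵀb)_c)))` is
integrable on `[0,1)^Q × ℝ^{cubes}` (`β > 0`, `z ≥ 0`). [folklore] -/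
theorem integrable_prod_form {β : ℝ} (hβ : 0 < β) {z : ℕ → ℝ} (hz : ∀ k, 0 < z k) (κ : CIdx d n → ℕ)
    (ψ : CIdx d n → ℝ) :
    Integrable (uncurry fun (b : QIdx d n → ℝ) (a : CIdx d n → ℝ) =>
        auxGauss β a * ∏ c, (1 + z (κ c) * Real.cos (κ c * (a c + ψ c + torusShift b c))))
      (((volume : Measure (QIdx d n → ℝ)).restrict (Set.pi univ (fun _ : QIdx d n => Ico (0 : ℝ) 1))).prod volume) := by
  have hcont : Continuous (uncurry fun (b : QIdx d n → ℝ) (a : CIdx d n → ℝ) =>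
      auxGauss β a * ∏ c, (1 + z (κ c) * Real.cos (κ c * (a c + ψ c + torusShift b c)))) := by
    refine ((continuous_auxGauss β).comp continuous_snd).mul (continuous_finsetProd _ fun c _ => ?_)
    refine continuous_const.add (continuous_const.mul (Real.continuous_cos.comp (continuous_const.mul ?_)))
    exact (((continuous_apply c).comp continuous_snd).add continuous_const).add
      ((continuous_apply c).comp (continuous_torusShift.comp continuous_fst))
  have hM : Integrable (fun p : (QIdx d n → ℝ) × (CIdx d n → ℝ) => (∏ c, (1 + z (κ c))) * auxGauss β p.2)
      (((volume : Measure (QIdx d n → ℝ)).restrict (Set.pi univ (fun _ : QIdx d n => Ico (0 : ℝ) 1))).prod volume) := by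
    have hc : IntegrableOn (fun _ : QIdx d n → ℝ => (∏ c, (1 + z (κ c)) : ℝ))
        (Set.pi univ (fun _ : QIdx d n => Ico (0 : ℝ) 1)) := integrableOn_box_of_continuous continuous_const
    exact hc.integrable.mul_prod (integrable_auxGauss hβ)
  refine hM.mono' hcont.aestronglyMeasurable (Filter.Eventually.of_forall fun p => ?_)
  simp only [uncurry]
  rw [Real.norm_eq_abs, abs_mul, abs_of_pos (auxGauss_pos β _), mul_comm]
  refine mul_le_mul_of_nonneg_right ?_ (auxGauss_pos β _).le
  rw [Finset.abs_prod]
  refine Finset.prod_le_prod (fun c _ => abs_nonneg _) fun c _ => ?_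
  refine (abs_add_le _ _).trans ?_
  rw [abs_one, abs_mul, abs_of_pos (hz _)]
  exact add_le_add_right (mul_le_of_le_one_right (hz _).le (Real.abs_cos_le_one _)) _

/-! ### The closed-ensemble expansion of one multiplicity pattern -/

/-- **FS82 Lemma 2 + (2.43)–(2.44) for one multiplicity pattern of the Villain monopole gas**
(regulator-free). [cite: FrohlichSpencerCMP1982, §2.6 Lemma 2, (2.41)–(2.44)] -/
theorem exists_closed_ensemble_expansion {β : ℝ} (hβ : 0 < β) {z : ℕ → ℝ} (hz : ∀ k, 0 < z k)
    (κ : CIdx d n → ℕ) (hκ : ∀ c, 1 ≤ κ c) (S : PIdx d n → ℝ) :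
    ∃ L : List (Term (CIdx d n)),
      (∀ t ∈ L, 0 < t.weight) ∧ weightSum L = 1 ∧
      (∀ t ∈ L, IsOneEnsemble adjC t.family) ∧
      (∀ t ∈ L, ∀ ρ ∈ t.family, ρ ≠ 0 ∧ ∀ b ∈ ρ.support, |ρ b| = κ b) ∧
      (∀ t ∈ L, ∀ ρ ∈ t.family, 0 ≤ t.activity ρ ∧
        t.activity ρ ≤ 3 ^ (nbhd adjC Finset.univ ρ.support).card * ∏ b ∈ ρ.support, z (κ b) ∧
        (EInt ρ ≠ 0 → t.activity ρ = 0)) ∧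
      (∀ t ∈ L, ∀ ρ ∈ t.family, IsAdjConnected adjC ρ.support) ∧
      (∫ b in Set.pi univ (fun _ : QIdx d n => Ico (0 : ℝ) 1), ∫ a, auxGauss β a *
          ∏ c, (1 + z (κ c) * Real.cos (κ c * (a c + auxShift S c + torusShift b c)))) =
        ∫ a, auxGauss β a * evalSum L (a + auxShift S) ∧
      (∫ b in Set.pi univ (fun _ : QIdx d n => Ico (0 : ℝ) 1), ∫ a, auxGauss β a *
          ∏ c, (1 + z (κ c) * Real.cos (κ c * (a c + torusShift b c)))) =
        ∫ a, auxGauss β a * evalSum L a := by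
  classical
  obtain ⟨L₀, hw, hws, hens, hdens, hact, hconn, hexp⟩ :=
    exists_oneEnsemble_expansion adjC adjC_symm Finset.univ (fun c => (κ c : ℤ))
      (fun c _ => by have := hκ c; omega) (fun c => z (κ c)) (fun c _ => (hz _).le)
  -- the integral identities, for a general shift
  have key : ∀ ψ : CIdx d n → ℝ,
      (∫ b in Set.pi univ (fun _ : QIdx d n => Ico (0 : ℝ) 1), ∫ a, auxGauss β a *
          ∏ c, (1 + z (κ c) * Real.cos (κ c * (a c + ψ c + torusShift b c)))) =
        ∫ a, auxGauss β a * evalSum (L₀.map closeT) (a + ψ) := by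
    intro ψ
    rw [integral_integral_swap (integrable_prod_form hβ hz κ ψ)]
    refine integral_congr_ae (Filter.Eventually.of_forall fun a => ?_)
    beta_reduce
    rw [integral_const_mul, ← integral_torus_evalSum L₀ hens (a + ψ)]
    congr 1
    refine integral_congr_ae (Filter.Eventually.of_forall fun b => ?_)
    beta_reduce
    rw [← hexp (a + ψ + torusShift b)]
    refine Finset.prod_congr rfl fun c _ => ?_
    simp only [Pi.add_apply, Int.cast_natCast]
  refine ⟨L₀.map closeT, ?_, ?_, ?_, ?_, ?_, ?_, ?_, ?_⟩
  · intro t ht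
    obtain ⟨t₀, ht₀, rfl⟩ := List.mem_map.1 ht
    exact hw t₀ ht₀
  · rw [weightSum_map_closeT, hws]
  · intro t ht
    obtain ⟨t₀, ht₀, rfl⟩ := List.mem_map.1 ht
    exact hens t₀ ht₀
  · intro t ht ρ hρ
    obtain ⟨t₀, ht₀, rfl⟩ := List.mem_map.1 ht
    obtain ⟨-, hne, habs⟩ := hdens t₀ ht₀ ρ hρ
    refine ⟨hne, fun b hb => ?_⟩
    rw [habs b hb, Nat.abs_cast]
  · intro t ht ρ hρ
    obtain ⟨t₀, ht₀, rfl⟩ := List.mem_map.1 ht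
    obtain ⟨h0, hle⟩ := hact t₀ ht₀ ρ hρ
    rw [closeT_activity]
    refine ⟨?_, ?_, fun hE => if_neg hE⟩
    · split_ifs
      · exact h0
      · exact le_rfl
    · split_ifs
      · exact hle
      · exact le_trans h0 hle
  · intro t ht
    obtain ⟨t₀, ht₀, rfl⟩ := List.mem_map.1 ht
    exact hconn t₀ ht₀
  · exact key (auxShift S)
  · simpa using key 0

end VillainAngle

end Literature.MathematicalPhysics.QuantumFieldTheory
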